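import Mathlib.Algebra.Order.BigOperators.Group.Finset
import Mathlib.Algebra.BigOperators.NatAntidiagonal
import Mathlib.Data.Nat.Choose.Sum
import Mathlib.Analysis.SpecialFunctions.Pow.Real
import Literature.MathematicalPhysics.QuantumFieldTheory.Dimock2011to13.QED3AntisymmetricKernels
import HarnessLib

/-!
# Dimock–Yuan, *Structural stability of the RG flow in the Gross–Neveu model*, §2.2 LEMMA 1: the weighted kernel norm
# `‖F‖_h = Σ_ℓ (h^ℓ∕ℓ!)‖F_ℓ‖_{C′}` is submultiplicative when `‖Alt(F_n ⊗ G_m)‖_{C′} ≤ ‖F_n‖_{C′}‖G_m‖_{C′}` — the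
# combinatorial core (29)–(31) PROVED in abstract (sequence) form

Topic `Literature/MathematicalPhysics/QuantumFieldTheory/DimockYuan2024`; sibling of `FieldTranslationNorm.lean` (LEMMA 9,
`‖F⁺‖_{h,h′} = ‖F‖_{h+h′}`), `FieldDerivativeNorm.lean`, `FieldVariationNorm.lean` (the other norm lemmas of §2.2), and of the
finite-lattice analogue `Dimock2011to13/QED3GrassmannNormedAlgebra.lean` (D8's `‖F‖_h = Σ_S h^{|S|}|c_S|`, submultiplicative).

statement-level skeleton of published theorems with citation tags; proofs where landed; nothing here is a claim about the Yang–Mills mass gap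

**The printed statement.**  J. Dimock, C. Yuan, *Structural stability of the RG flow in the Gross–Neveu model*,
arXiv:2303.07916 [DimockYuan2024GNFlow], §2.2, p.6 L38 – p.7 L13 of the held text layer `paper:arxiv-2303.07916`:
*"Lemma 1. Suppose that `‖Alt(F_n ⊗ G_m)‖_{C′} ≤ ‖F_n‖_{C′}‖G_m‖_{C′}` (27). Then if `F ∈ 𝒢_h` and `G ∈ 𝒢_h` then `FG ∈ 𝒢_h` and
`‖FG‖_h ≤ ‖F‖_h‖G‖_h`.  Proof. Let `H = FG`. Then `H = Σ_ℓ (1∕ℓ!)∫H_ℓ(ξ₁,…,ξ_ℓ)ψ(ξ₁)⋯ψ(ξ_ℓ)dξ` (28) where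
`H_ℓ = Σ_{n+m=ℓ} (ℓ!∕(n!m!)) Alt(F_n ⊗ G_m)` (29).  Then `‖H_ℓ‖_{C′} ≤ Σ_{n+m=ℓ} (ℓ!∕(n!m!))‖Alt(F_n ⊗ G_m)‖_{C′} ≤
Σ_{n+m=ℓ} (ℓ!∕(n!m!))‖F_n‖_{C′}‖G_m‖_{C′}` (30) and we have the announced
`‖H‖_h = Σ_ℓ (h^ℓ∕ℓ!)‖H_ℓ‖_{C′} ≤ Σ_{n,m} (h^{n+m}∕(n!m!))‖F_n‖_{C′}‖G_m‖_{C′} = ‖F‖_h‖G‖_h` (31)"*.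

**What is formalised (the arithmetic of (29)–(31), model-free).**  For degree-wise kernel norms `a n = ‖F_n‖`, `b m = ‖G_m‖`,
`c ℓ = ‖H_ℓ‖` (non-negative reals, degrees `≤ N` — a finite Grassmann algebra has finitely many degrees) and `h ≥ 0`:
* `kernelNorm h N a = Σ_{ℓ ≤ N} (h^ℓ∕ℓ!)·a ℓ` — the weighted norm `‖·‖_h` of (21)∕(31) as a function of the degree-wise norms;
* **`kernelNorm_le_mul_of_degreewise`** — LEMMA 1's conclusion: if (30) `c ℓ ≤ Σ_{n+m=ℓ} (ℓ!∕(n!m!)) a n · b m` for every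
  `ℓ ≤ N`, then `Σ_{ℓ≤N} (h^ℓ∕ℓ!) c ℓ ≤ (Σ_{n≤N} (h^n∕n!) a n)(Σ_{m≤N} (h^m∕m!) b m)` — via the term identity
  `(h^ℓ∕ℓ!)(ℓ!∕(n!m!)) = (h^n∕n!)(h^m∕m!)` (`weight_mul_multinomial`) and the inclusion of the index set `{n + m ≤ N}` in
  `{n ≤ N} × {m ≤ N}` (the printed `=` in (31) sums over all `n, m`; with a degree cut-off it is `≤`, equality when
  `a n = 0` for `2n > N` etc.);
* **`sum_antidiagonal_weight_eq`** — the exact Cauchy-product identity behind (31) without cut-off losses: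
  `Σ_{ℓ≤N} Σ_{n+m=ℓ} (h^n∕n!·a n)(h^m∕m!·b m) = Σ_{(n,m): n+m ≤ N} (h^n∕n!·a n)(h^m∕m!·b m)`.

* **`hNorm_eq_kernelNorm`** — the finite-lattice instance: with the `ℓ¹` kernel norms `a r = ‖f_r‖₁` on a finite set of
  generators, `‖·‖_h` of (21) is the tree's monomial norm `QED3TorusI.hNorm h` ((299) of the 3-torus paper I,
  `hNorm_eq_299`), for which LEMMA 1's conclusion is the tree's `QED3TorusI.hNorm_mul_le`.

Scope: the hypothesis (27) (LEMMA 2, the `C′`-dual norm estimate with three derivatives per variable on the torus) is not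
modelled; this file is the bookkeeping step (29)–(31) plus the finite-lattice dictionary.
-/

noncomputable section

namespace Literature.MathematicalPhysics.QuantumFieldTheory.DimockYuan2024.GradedKernelNorm

open Finset

/-- The weighted kernel norm `‖F‖_h = Σ_{ℓ ≤ N} (h^ℓ∕ℓ!)‖F_ℓ‖_{C′}` as a function of the degree-wise norms `a ℓ = ‖F_ℓ‖_{C′}`
((21): `‖F‖_h = Σ_n (h^n∕n!)‖F_n‖_{C′}`). [cite: DimockYuan2024GNFlow, §2.2 (21) p.6; Lemma 1 (31) p.7 L9–13] -/
def kernelNorm (h : ℝ) (N : ℕ) (a : ℕ → ℝ) : ℝ :=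
  ∑ ℓ ∈ range (N + 1), h ^ ℓ / ℓ.factorial * a ℓ

/-- Unfolding. [cite: DimockYuan2024GNFlow, §2.2 (21) p.6] -/
theorem kernelNorm_def (h : ℝ) (N : ℕ) (a : ℕ → ℝ) :
    kernelNorm h N a = ∑ ℓ ∈ range (N + 1), h ^ ℓ / ℓ.factorial * a ℓ := rfl

/-- `‖·‖_h` is non-negative on non-negative degree-wise norms (`h ≥ 0`). [cite: DimockYuan2024GNFlow, §2.2 (21) p.6] -/
theorem kernelNorm_nonneg {h : ℝ} (hh : 0 ≤ h) (N : ℕ) {a : ℕ → ℝ} (ha : ∀ n, 0 ≤ a n) : 0 ≤ kernelNorm h N a :=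
  sum_nonneg fun ℓ _ => mul_nonneg (div_nonneg (pow_nonneg hh _) (Nat.cast_nonneg _)) (ha ℓ)

/-- **The term identity of (31)**: `(h^ℓ∕ℓ!)·(ℓ!∕(n!m!)) = (h^n∕n!)·(h^m∕m!)` for `n + m = ℓ`.
[cite: DimockYuan2024GNFlow, §2.2 Lemma 1 proof (29)–(31) p.6 L47 – p.7 L13] -/
theorem weight_mul_multinomial (h : ℝ) {n m ℓ : ℕ} (hℓ : n + m = ℓ) :
    h ^ ℓ / ℓ.factorial * (ℓ.factorial / (n.factorial * m.factorial)) = h ^ n / n.factorial * (h ^ m / m.factorial) := by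
  subst hℓ
  have hn : (n.factorial : ℝ) ≠ 0 := Nat.cast_ne_zero.mpr (Nat.factorial_ne_zero n)
  have hm : (m.factorial : ℝ) ≠ 0 := Nat.cast_ne_zero.mpr (Nat.factorial_ne_zero m)
  have hl : ((n + m).factorial : ℝ) ≠ 0 := Nat.cast_ne_zero.mpr (Nat.factorial_ne_zero _)
  rw [pow_add]
  field_simp

/-- **(30) summed with the weights, term by term**: `(h^ℓ∕ℓ!) Σ_{n+m=ℓ} (ℓ!∕(n!m!)) a_n b_m = Σ_{n+m=ℓ} (h^n a_n∕n!)(h^m b_m∕m!)`.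
[cite: DimockYuan2024GNFlow, §2.2 Lemma 1 proof (30)–(31) p.7 L1–13] -/
theorem weight_mul_sum_antidiagonal (h : ℝ) (a b : ℕ → ℝ) (ℓ : ℕ) :
    h ^ ℓ / ℓ.factorial * ∑ p ∈ antidiagonal ℓ, (ℓ.factorial / (p.1.factorial * p.2.factorial)) * (a p.1 * b p.2) =
      ∑ p ∈ antidiagonal ℓ, (h ^ p.1 / p.1.factorial * a p.1) * (h ^ p.2 / p.2.factorial * b p.2) := by
  rw [mul_sum]
  refine sum_congr rfl fun p hp => ?_
  rw [HasAntidiagonal.mem_antidiagonal] at hp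
  rw [← mul_assoc, weight_mul_multinomial h hp]
  ring

/-- The antidiagonals of distinct levels are disjoint. [folklore] -/
private theorem pairwiseDisjoint_antidiagonal (s : Finset ℕ) :
    (s : Set ℕ).PairwiseDisjoint fun ℓ => antidiagonal ℓ := by
  intro i _ j _ hij
  rw [Function.onFun, disjoint_left]
  intro p hi hj
  rw [HasAntidiagonal.mem_antidiagonal] at hi hj
  exact hij (hi.symm.trans hj)

/-- **The exact Cauchy-product bookkeeping of (31)**: summing the antidiagonals `n + m = ℓ` over `ℓ ≤ N` is summing over the
pairs with `n + m ≤ N`. [cite: DimockYuan2024GNFlow, §2.2 Lemma 1 proof (31) p.7 L9–13] -/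
theorem sum_antidiagonal_weight_eq (N : ℕ) (w v : ℕ → ℝ) :
    ∑ ℓ ∈ range (N + 1), ∑ p ∈ antidiagonal ℓ, w p.1 * v p.2 =
      ∑ p ∈ (range (N + 1)).biUnion antidiagonal, w p.1 * v p.2 :=
  (sum_biUnion (pairwiseDisjoint_antidiagonal _)).symm

/-- The pairs with `n + m ≤ N` lie in the square `{n ≤ N} × {m ≤ N}`. [folklore] -/
private theorem biUnion_antidiagonal_subset_product (N : ℕ) :
    (range (N + 1)).biUnion antidiagonal ⊆ range (N + 1) ×ˢ range (N + 1) := by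
  intro p hp
  rw [mem_biUnion] at hp
  obtain ⟨ℓ, hℓ, hp⟩ := hp
  rw [mem_range] at hℓ
  rw [HasAntidiagonal.mem_antidiagonal] at hp
  rw [mem_product, mem_range, mem_range]
  omega

/-- **Dimock–Yuan LEMMA 1 (the arithmetic of (29)–(31))**: if the degree-`ℓ` kernel norm of the product obeys (30),
`c ℓ ≤ Σ_{n+m=ℓ} (ℓ!∕(n!m!))·a n·b m` (from (27) `‖Alt(F_n ⊗ G_m)‖ ≤ ‖F_n‖‖G_m‖` and (29)
`H_ℓ = Σ_{n+m=ℓ}(ℓ!∕(n!m!))Alt(F_n ⊗ G_m)`), with `a, b ≥ 0` and `h ≥ 0`, then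

  `‖H‖_h = Σ_{ℓ≤N} (h^ℓ∕ℓ!) c ℓ ≤ (Σ_{n≤N} (h^n∕n!) a n)·(Σ_{m≤N} (h^m∕m!) b m) = ‖F‖_h ‖G‖_h`

(the printed chain (31); with the degree cut-off `N` the middle `=` of (31) becomes `≤`, dropping the non-negative terms
with `n + m > N`). [cite: DimockYuan2024GNFlow, §2.2 Lemma 1 (27)–(31) p.6 L38 – p.7 L13] -/
theorem kernelNorm_le_mul_of_degreewise {h : ℝ} (hh : 0 ≤ h) (N : ℕ) {a b c : ℕ → ℝ} (ha : ∀ n, 0 ≤ a n)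
    (hb : ∀ m, 0 ≤ b m)
    (h30 : ∀ ℓ ∈ range (N + 1),
      c ℓ ≤ ∑ p ∈ antidiagonal ℓ, (ℓ.factorial / (p.1.factorial * p.2.factorial)) * (a p.1 * b p.2)) :
    kernelNorm h N c ≤ kernelNorm h N a * kernelNorm h N b := by
  have hw : ∀ n, 0 ≤ h ^ n / n.factorial := fun n => div_nonneg (pow_nonneg hh _) (Nat.cast_nonneg _)
  calc kernelNorm h N c
      ≤ ∑ ℓ ∈ range (N + 1), h ^ ℓ / ℓ.factorial *
          ∑ p ∈ antidiagonal ℓ, (ℓ.factorial / (p.1.factorial * p.2.factorial)) * (a p.1 * b p.2) :=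
        sum_le_sum fun ℓ hℓ => mul_le_mul_of_nonneg_left (h30 ℓ hℓ) (hw ℓ)
    _ = ∑ ℓ ∈ range (N + 1), ∑ p ∈ antidiagonal ℓ,
          (h ^ p.1 / p.1.factorial * a p.1) * (h ^ p.2 / p.2.factorial * b p.2) :=
        sum_congr rfl fun ℓ _ => weight_mul_sum_antidiagonal h a b ℓ
    _ = ∑ p ∈ (range (N + 1)).biUnion antidiagonal,
          (h ^ p.1 / p.1.factorial * a p.1) * (h ^ p.2 / p.2.factorial * b p.2) :=
        sum_antidiagonal_weight_eq N (fun n => h ^ n / n.factorial * a n) (fun m => h ^ m / m.factorial * b m)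
    _ ≤ ∑ p ∈ range (N + 1) ×ˢ range (N + 1),
          (h ^ p.1 / p.1.factorial * a p.1) * (h ^ p.2 / p.2.factorial * b p.2) :=
        sum_le_sum_of_subset_of_nonneg (biUnion_antidiagonal_subset_product N)
          fun p _ _ => mul_nonneg (mul_nonneg (hw _) (ha _)) (mul_nonneg (hw _) (hb _))
    _ = kernelNorm h N a * kernelNorm h N b := by
        rw [kernelNorm, kernelNorm, sum_mul_sum,
          ← sum_product (range (N + 1)) (range (N + 1))
            (fun p : ℕ × ℕ => (h ^ p.1 / p.1.factorial * a p.1) * (h ^ p.2 / p.2.factorial * b p.2))]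

/-- **LEMMA 1 for the exact product**: without degree cut-off losses — if `a n = 0` and `b m = 0` beyond degrees with
`N_a + N_b ≤ N`, the inequality of (31) is the printed chain with `=` in the middle; here the convenient corollary that
the product of two elements of `𝒢_h` has finite `‖·‖_h` bounded by the product of the norms, stated for the total degree
bound `N`. [cite: DimockYuan2024GNFlow, §2.2 Lemma 1 (31) p.7 L9–13] -/
theorem kernelNorm_mul_le {h : ℝ} (hh : 0 ≤ h) (N : ℕ) {a b : ℕ → ℝ} (ha : ∀ n, 0 ≤ a n) (hb : ∀ m, 0 ≤ b m) :
    kernelNorm h N (fun ℓ => ∑ p ∈ antidiagonal ℓ, (ℓ.factorial / (p.1.factorial * p.2.factorial)) * (a p.1 * b p.2)) ≤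
      kernelNorm h N a * kernelNorm h N b :=
  kernelNorm_le_mul_of_degreewise hh N ha hb fun _ _ => le_rfl


/-! ## The finite-lattice instance: `‖·‖_h` of (21) IS the tree's monomial norm `hNorm h` ((299) of the 3-torus paper I) -/

section Lattice

open Literature.MathematicalPhysics.QuantumLattice Literature.MathematicalPhysics.QuantumFieldTheory.Dimock2011to13

variable {𝕜 : Type*} [RCLike 𝕜] {ι : Type*} [LinearOrder ι] [Fintype ι]

/-- **On a finite set of generators with the `ℓ¹` kernel norm, Dimock–Yuan's `‖F‖_h = Σ_n (h^n∕n!)‖F_n‖` (21) is the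
tree's monomial-basis norm `hNorm h F = Σ_S h^{|S|}|c_S|`** (the 3-torus paper's (299), `QED3TorusI.hNorm_eq_299`): with
`a r = ‖f_r‖₁ = Σ_ξ |f_r(ξ)|`, `kernelNorm h |ι| a = hNorm h F`.  For this instance LEMMA 1's conclusion is the tree's
`QED3TorusI.hNorm_mul_le`. [cite: DimockYuan2024GNFlow, §2.2 (21) p.6, Lemma 1 (31) p.7; Dimock2002QED3TorusI, App. B (299)
p.62 L9–13] -/
theorem hNorm_eq_kernelNorm (h : ℝ) (F : GrassmannAlgebra 𝕜 ι) :
    QED3TorusI.hNorm h F = kernelNorm h (Fintype.card ι) (fun r => ∑ ξ : Fin r → ι, ‖QED3TorusI.kernel F r ξ‖) := by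
  rw [QED3TorusI.hNorm_eq_299, kernelNorm]

end Lattice

end Literature.MathematicalPhysics.QuantumFieldTheory.DimockYuan2024.GradedKernelNorm

end
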